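import Summits.Ventures.Crystal3D.Theorems.StickyWulffConstantTextureLiminfTexShadowFluxPairSteerMean
import HarnessLib

/-!
# TexShadow row (e) / EDGE-ON flux class: WEAK ⇒ STEEP TILT (a plate tilted by `≤ 60°` launches a family of strength `≥ 1/2` on every bilayer)
# (lane T, crux `TextureLiminfV5`, stmt-Ventures-23912, EDGE-ON flux sliver; cf-p1 (cxcvii)(a) / (cci); 19480-p2's critique point (v); 19480-p1 g16)

HONEST FRAMING. Venture `Summits/Ventures/Crystal3D` (cell `crystal3d-full`), route `route-Ventures-StickyWulffConstant`, helper
`--supports` the law-v5 crux `TextureLiminfV5` (stmt-Ventures-23912).  Sphere geometry only; standard axioms; no certificate, no walker, no wall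
law; rung F-C1 not moved.

THE POINT.  The flux-pair sliver (`FluxPairFailAt`, 19480-p2's '…EdgeOnRepCover', pending) consists of pairs in which BOTH plates are weak.  This
file quantifies «weak ⇒ nearly edge-on», the tilt bound the hybrid adjacent-mean/row closure needs for `RowSteep` (row rise `≥ √2/2 ⇔ β ≥ 54.7°`)
and for `exists_inPlane_slot_rise_ge_three_quarters` (p713118, `⟪L e₃, e⟫² ≤ 1/4`):
* `fluxTilt_core` / `fluxTilt_core_sharp` — in the best-of-six coordinates `(pk, Q, H)` (`3pk² + Q² + (3/2)H² = 1`, `0 ≤ Q ≤ pk`), `H² ≥ 1/6`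
  (tilt `≤ 60°`) forces the near capper rise `≥ 1/2`, and `H² ≥ 1/30` (tilt `≤ 77°`) forces `≥ 9/20`;
* **`exists_rep_steerLaunch_half_of_tilt`** / **`exists_rep_steerLaunch_sharp_of_tilt`** (via the parametric `…_of_tilt_core`) — a plate with
  `⟪L e₃, e⟫² ≥ 1/4` (resp. `≥ 1/20`) has, in its given or twin presentation, a launch `(z, v)` with `SteerLaunchAt (1/3) F σ e z v` for every word and
  `steerRise ≥ 1/2` (resp. `≥ 9/20`) on EVERY bilayer;
* `exists_rep_steerLaunch_floor` — EVERY plate has such a launch with `steerRise ≥ √3/6` on every bilayer (from p713115);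
* **`exists_rep_launches_sum_ge_of_tilt`** — hence if ONE plate of a pair is tilted by `≤ 60°`, the pair has presentations and launches with
  `steerRise₁ i + steerRise₂ j ≥ 9/20 + √3/6 ≥ √2·13/25` for ALL `i, j`: such pairs are never in the flux-pair sliver — contrapositively BOTH plates of a
  sliver pair satisfy `⟪L e₃, e₃⟫² < 1/20` (`β > 77° > 54.7°`), so their in-layer rows are `RowSteep` and rise by `≥ 3/4`.
WHAT THIS IS NOT: not the `FluxPairFailAt` corollary itself (one line once '…EdgeOnRepCover' lands), no certificate; F-C1 not moved.
-/

noncomputable section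

open scoped BigOperators InnerProductSpace

namespace Summit.Ventures.Crystal3D.Cruxes.TextureLiminf.TexShadow

open Summit.Ventures.Crystal3D Summit.Ventures.Crystal3D.Theorems
open Literature.MathematicalPhysics.StatisticalMechanics (basalMirror)

/-! ## Real cores: tilt ⇒ near capper bounded below -/

/-- **Tilt core, 60°.**  `3pk² + Q² + (3/2)H² = 1`, `0 ≤ Q ≤ pk`, `0 ≤ H`, `H² ≥ 1/6` ⇒ `H + pk/2 + Q/2 ≥ 1/2`. -/
theorem fluxTilt_core (pk Q H : ℝ) (hH : 0 ≤ H) (hQ0 : 0 ≤ Q) (hQ : Q ≤ pk) (hsph : 3 * pk ^ 2 + Q ^ 2 + 3 / 2 * H ^ 2 = 1)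
    (htilt : 1 / 6 ≤ H ^ 2) : 1 / 2 ≤ H + pk / 2 + Q / 2 := by
  have hpk0 : 0 ≤ pk := hQ0.trans hQ
  have hH4 : 2 / 5 ≤ H := by nlinarith
  by_cases hH2 : 1 / 2 ≤ H
  · linarith
  · have hlt : H < 1 / 2 := lt_of_not_ge hH2
    have hpk2 : 5 / 8 ≤ 4 * pk ^ 2 := by nlinarith
    have hpk : 3 / 8 ≤ pk := by nlinarith
    linarith

/-- **Tilt core, sharp (77°).**  Same data with `H² ≥ 1/30` ⇒ `H + pk/2 + Q/2 ≥ 9/20` (uses `(pk + Q)² ≥ (1 − (3/2)H²)/3`, the minimum of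
`pk + Q` on the arc being at `Q = 0`). -/
theorem fluxTilt_core_sharp (pk Q H : ℝ) (hH : 0 ≤ H) (hQ0 : 0 ≤ Q) (hQ : Q ≤ pk) (hsph : 3 * pk ^ 2 + Q ^ 2 + 3 / 2 * H ^ 2 = 1)
    (htilt : 1 / 30 ≤ H ^ 2) : 9 / 20 ≤ H + pk / 2 + Q / 2 := by
  have hpk0 : 0 ≤ pk := hQ0.trans hQ
  have hH1 : 9 / 50 ≤ H := by nlinarith
  by_cases hH2 : 9 / 20 ≤ H
  · linarith
  · have hlt : H < 9 / 20 := lt_of_not_ge hH2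
    set S : ℝ := pk + Q with hS
    have hS0 : 0 ≤ S := by rw [hS]; linarith
    -- (pk + Q)² ≥ pk² + 3Q² ≥ (3pk² + Q²)/3
    have hS2 : (1 - 3 / 2 * H ^ 2) / 3 ≤ S ^ 2 := by
      rw [hS]; nlinarith [mul_nonneg hQ0 (sub_nonneg.2 hQ)]
    -- (1 − 1.5H²)/3 ≥ (9/10 − 2H)² on [9/50, 9/20]
    have hpoly : (9 / 10 - 2 * H) ^ 2 ≤ (1 - 3 / 2 * H ^ 2) / 3 := by nlinarith
    have hS1 : 9 / 10 - 2 * H ≤ S := by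
      have h0 : 0 ≤ 9 / 10 - 2 * H := by linarith
      nlinarith
    linarith

/-- `√2·(13/25) ≤ 1/2 + √3/6`. -/
theorem sqrt_two_mul_c0_le_half_add : Real.sqrt 2 * (13 / 25) ≤ 1 / 2 + Real.sqrt 3 / 6 := by
  have h2 : Real.sqrt 2 ≤ 3 / 2 := by
    rw [show (3 / 2 : ℝ) = Real.sqrt ((3 / 2) ^ 2) by rw [Real.sqrt_sq (by norm_num)]]
    exact Real.sqrt_le_sqrt (by norm_num)
  have h3 : (1.7 : ℝ) ≤ Real.sqrt 3 := by
    rw [show (1.7 : ℝ) = Real.sqrt (1.7 ^ 2) by rw [Real.sqrt_sq (by norm_num)]]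
    exact Real.sqrt_le_sqrt (by norm_num)
  nlinarith

/-- `√2·(13/25) ≤ 9/20 + √3/6` (`0.7354 ≤ 0.7387`). -/
theorem sqrt_two_mul_c0_le_sharp_add : Real.sqrt 2 * (13 / 25) ≤ 9 / 20 + Real.sqrt 3 / 6 := by
  have h2 : Real.sqrt 2 ≤ 1.4143 := by
    rw [show (1.4143 : ℝ) = Real.sqrt (1.4143 ^ 2) by rw [Real.sqrt_sq (by norm_num)]]
    exact Real.sqrt_le_sqrt (by norm_num)
  have h3 : (1.732 : ℝ) ≤ Real.sqrt 3 := by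
    rw [show (1.732 : ℝ) = Real.sqrt (1.732 ^ 2) by rw [Real.sqrt_sq (by norm_num)]]
    exact Real.sqrt_le_sqrt (by norm_num)
  nlinarith

/-! ## Frame level: tilt ⇒ a launch of controlled strength -/

/-- **Tilt ⇒ controlled launch, frame level.**  As `exists_launch_mean_of_rises`, plus a tilt hypothesis `(2/3)·((G⁻¹ e)₂)² ≥ θ` and a real
core `hcore` turning it into a bound `τ` for the near capper: the `z`-best ∇-capper of the produced launch rises by `≥ τ`. -/
theorem exists_launch_of_tilt_core {θ τ : ℝ}
    (hcore : ∀ pk Q H : ℝ, 0 ≤ H → 0 ≤ Q → Q ≤ pk → 3 * pk ^ 2 + Q ^ 2 + 3 / 2 * H ^ 2 = 1 → θ ≤ H ^ 2 → τ ≤ H + pk / 2 + Q / 2)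
    (G : E3 ≃ₗᵢ[ℝ] E3) {e : E3} (he : ‖e‖ = 1) (hG : 0 ≤ (G.symm e) 2) (htilt : θ ≤ 2 / 3 * ((G.symm e) 2) ^ 2)
    {v wa wb : E3} (hv : v = upSlot₁ ∨ v = upSlot₂ ∨ v = upSlot₃) (hwa : wa = upSlot₁ ∨ wa = upSlot₂ ∨ wa = upSlot₃)
    (hwb : wb = upSlot₁ ∨ wb = upSlot₂ ∨ wb = upSlot₃) (hav : wa ≠ v) (hbv : wb ≠ v) (hab : wa ≠ wb)
    (hhalf : 1 / 2 ≤ ⟪G v, e⟫_ℝ) (hka : -⟪G (basalMirror wa), e⟫_ℝ ≤ ⟪G v, e⟫_ℝ)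
    (hkb : -⟪G (basalMirror wb), e⟫_ℝ ≤ ⟪G v, e⟫_ℝ) :
    ∃ z : E3, ‖z‖ = 1 ∧ ‖z - e‖ ≤ 1 / 3 ∧ Real.sqrt 2 / 2 ≤ ⟪G v, z⟫_ℝ ∧
      τ ≤ ⟪G (basalMirror (bestCapper (twinFrame G (G e₃)) (G e₃) z)), e⟫_ℝ := by
  wlog hba : -⟪G (basalMirror wb), e⟫_ℝ ≤ -⟪G (basalMirror wa), e⟫_ℝ generalizing wa wb
  · exact this hwb hwa hbv hav (Ne.symm hab) hkb hka (le_of_not_ge hba)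
  set ν : E3 := G.symm e with hνdef
  have hνn : ‖ν‖ = 1 := by rw [hνdef, LinearIsometryEquiv.norm_map, he]
  have hGe : ∀ x : E3, ⟪G x, e⟫_ℝ = ⟪x, ν⟫_ℝ := fun x => inner_map_eq_inner_symm G x e
  simp only [hGe] at hhalf hka hkb hba ⊢
  have hvn : ‖v‖ = 1 := norm_upSlot_eq_one hv
  set A : ℝ := ⟪v, ν⟫_ℝ with hA
  set H : ℝ := Real.sqrt (2 / 3) * ν 2 with hH
  have hH0 : 0 ≤ H := mul_nonneg (Real.sqrt_nonneg _) hG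
  have hH2 : θ ≤ H ^ 2 := by
    rw [hH, mul_pow, Real.sq_sqrt (by norm_num)]; exact htilt
  have hRa : -⟪basalMirror wa, ν⟫_ℝ = 2 * H - ⟪wa, ν⟫_ℝ := capperRise_eq hwa ν
  have hRb : -⟪basalMirror wb, ν⟫_ℝ = 2 * H - ⟪wb, ν⟫_ℝ := capperRise_eq hwb ν
  obtain ⟨hsum, hsph⟩ := slot_rises_perm hv hwa hwb hav hbv hab ν hνn
  have hsph' : 3 * (A - H) ^ 2 + (⟪wb, ν⟫_ℝ - ⟪wa, ν⟫_ℝ) ^ 2 + 3 / 2 * H ^ 2 = 1 := by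
    have e1 : ⟪wa, ν⟫_ℝ + ⟪wb, ν⟫_ℝ - 2 * H = H - A := by linarith
    linear_combination hsph - (⟪wa, ν⟫_ℝ + ⟪wb, ν⟫_ℝ - 2 * H + (H - A)) * e1
  have hQ0 : 0 ≤ ⟪wb, ν⟫_ℝ - ⟪wa, ν⟫_ℝ := by linarith
  have hcore' := hcore (A - H) (⟪wb, ν⟫_ℝ - ⟪wa, ν⟫_ℝ) H hH0 hQ0 (by linarith) hsph' hH2
  -- the arc steering and its best capper
  have ht : steerSteepCos (1 / 3) ≤ A := steerSteepCos_third_lt_half.le.trans hhalf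
  have ht0 : 0 ≤ steerSteepCos (1 / 3) := (by norm_num : (0:ℝ) ≤ 1 / 4).trans steerSteepCos_third_ge_quarter
  obtain ⟨ζ, α, β, hα, hβ, hζ, hζn, hζν, hζv⟩ := exists_model_steering v ν (1 / 3) A hvn hνn rfl (by norm_num) (by norm_num) ht ht0
  obtain ⟨u, hu, hcap, hmin⟩ := bestCapper_eq_neg_minimiser G ζ
  have hrise : -⟪basalMirror wa, ν⟫_ℝ ≤ ⟪basalMirror (bestCapper (twinFrame G (G e₃)) (G e₃) (G ζ)), ν⟫_ℝ := by
    rw [hcap, map_neg, inner_neg_left]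
    exact capperRise_ge_of_minimiser hv hα hβ hζ hu hmin hwa hav
  refine ⟨G ζ, by rw [LinearIsometryEquiv.norm_map, hζn], ?_, by rw [LinearIsometryEquiv.inner_map_map]; exact hζv, ?_⟩
  · have : G ζ - e = G (ζ - ν) := by rw [map_sub, hνdef, LinearIsometryEquiv.apply_symm_apply]
    rw [this, LinearIsometryEquiv.norm_map]; exact hζν
  · linarith

/-! ## Plate level -/

/-- The tilt is presentation-invariant: `((upFrame F e)⁻¹ e)₂² = ⟪L e₃, e⟫²` for `F ∈ {L, twinRepFrame L}`. -/
theorem upFrame_symm_apply_two_sq (L : E3 ≃ₗᵢ[ℝ] E3) (e : E3) :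
    (((upFrame L e).symm e) 2) ^ 2 = ⟪L e₃, e⟫_ℝ ^ 2 ∧ (((upFrame (twinRepFrame L) e).symm e) 2) ^ 2 = ⟪L e₃, e⟫_ℝ ^ 2 := by
  have he3 : (e₃ : E3) = EuclideanSpace.single (2 : Fin 3) (1 : ℝ) := rfl
  have hcoord : ∀ M : E3 ≃ₗᵢ[ℝ] E3, (M.symm e) 2 = ⟪M e₃, e⟫_ℝ := by
    intro M
    rw [← LinearIsometryEquiv.inner_map_map M.symm (M e₃) e, LinearIsometryEquiv.symm_apply_apply, he3,
      EuclideanSpace.inner_single_left]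
    simp
  have hbm : ∀ x : E3, (basalMirror x) 2 = -x 2 := fun x => by
    rw [Literature.MathematicalPhysics.StatisticalMechanics.basalMirror_apply_coord]; simp
  have hup : ∀ M : E3 ≃ₗᵢ[ℝ] E3, (((upFrame M e).symm e) 2) ^ 2 = ((M.symm e) 2) ^ 2 := by
    intro M
    unfold upFrame
    split_ifs
    · rfl
    · rw [LinearIsometryEquiv.symm_trans, LinearIsometryEquiv.trans_apply]
      have hb : ∀ x : E3, basalMirror.symm x = basalMirror x := fun x =>
        calc basalMirror.symm x = basalMirror.symm (basalMirror (basalMirror x)) := by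
              rw [Literature.MathematicalPhysics.StatisticalMechanics.basalMirror_basalMirror]
          _ = basalMirror x := basalMirror.symm_apply_apply _
      rw [hb, hbm]; ring
  refine ⟨by rw [hup, hcoord], by rw [hup, twinRepFrame_symm_apply_two, hcoord]⟩

/-- **Tilt ⇒ controlled launch, plate level (parametric).**  With a real core `hcore : θ ≤ H² ⇒ τ ≤ near capper` and `τ ≤ 1/2`: if
`(2/3)·⟪L e₃, e⟫² ≥ θ` (unit `e`), there are `F ∈ {L, twinRepFrame L}`, a reference up-slot `v` and a steering `z` with `SteerLaunchAt (1/3) F σ e z v` for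
every word (needs `τ ≥ 1/4`), slot rise `≥ 1/2`, capper rise `≥ τ`, hence `steerRise ≥ τ` on every bilayer. -/
theorem exists_rep_steerLaunch_of_tilt_core {θ τ : ℝ} (hτ4 : 1 / 4 ≤ τ) (hτ2 : τ ≤ 1 / 2)
    (hcore : ∀ pk Q H : ℝ, 0 ≤ H → 0 ≤ Q → Q ≤ pk → 3 * pk ^ 2 + Q ^ 2 + 3 / 2 * H ^ 2 = 1 → θ ≤ H ^ 2 → τ ≤ H + pk / 2 + Q / 2)
    (L : E3 ≃ₗᵢ[ℝ] E3) {e : E3} (he : ‖e‖ = 1) (htilt : θ ≤ 2 / 3 * ⟪L e₃, e⟫_ℝ ^ 2) :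
    ∃ F : E3 ≃ₗᵢ[ℝ] E3, (F = L ∨ F = twinRepFrame L) ∧ ∃ v z : E3,
      (v = upSlot₁ ∨ v = upSlot₂ ∨ v = upSlot₃) ∧ (∀ σ : ℤ → ℤ, SteerLaunchAt (1 / 3) F σ e z v) ∧
      1 / 2 ≤ ⟪upFrame F e v, e⟫_ℝ ∧
      τ ≤ ⟪upFrame F e (basalMirror (bestCapper (twinFrame (upFrame F e) (upFrame F e e₃)) (upFrame F e e₃) z)), e⟫_ℝ ∧
      ∀ (w : ℤ → ℤ) (i : ℤ), τ ≤ steerRise (upFrame F e) w e z v i := by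
  set G₀ := upFrame L e with hG₀
  set ν : E3 := G₀.symm e with hνdef
  have hνn : ‖ν‖ = 1 := by rw [hνdef, LinearIsometryEquiv.norm_map, he]
  have hν2 : 0 ≤ ν 2 := upFrame_axis_nonneg L e
  have hGe : ∀ x : E3, ⟪G₀ x, e⟫_ℝ = ⟪x, ν⟫_ℝ := fun x => inner_map_eq_inner_symm G₀ x e
  obtain ⟨n12, n13, n23⟩ := upSlots_ne
  have hu1 : upSlot₁ = upSlot₁ ∨ upSlot₁ = upSlot₂ ∨ upSlot₁ = upSlot₃ := Or.inl rfl
  have hu2 : upSlot₂ = upSlot₁ ∨ upSlot₂ = upSlot₂ ∨ upSlot₂ = upSlot₃ := Or.inr (Or.inl rfl)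
  have hu3 : upSlot₃ = upSlot₁ ∨ upSlot₃ = upSlot₂ ∨ upSlot₃ = upSlot₃ := Or.inr (Or.inr rfl)
  obtain ⟨s1, s2, s3⟩ := upSlots_mem_fccSlots
  obtain ⟨htilt₀, htiltₜ⟩ := upFrame_symm_apply_two_sq L e
  have hT0 : θ ≤ 2 / 3 * ((G₀.symm e) 2) ^ 2 := by rw [hG₀, htilt₀]; exact htilt
  have hTt : θ ≤ 2 / 3 * (((upFrame (twinRepFrame L) e).symm e) 2) ^ 2 := by rw [htiltₜ]; exact htilt
  -- packaging
  have pack : ∀ (F : E3 ≃ₗᵢ[ℝ] E3) (v : E3), (F = L ∨ F = twinRepFrame L) → (v = upSlot₁ ∨ v = upSlot₂ ∨ v = upSlot₃) →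
      1 / 2 ≤ ⟪upFrame F e v, e⟫_ℝ →
      (∃ z : E3, ‖z‖ = 1 ∧ ‖z - e‖ ≤ 1 / 3 ∧ Real.sqrt 2 / 2 ≤ ⟪upFrame F e v, z⟫_ℝ ∧
        τ ≤ ⟪upFrame F e (basalMirror (bestCapper (twinFrame (upFrame F e) (upFrame F e e₃)) (upFrame F e e₃) z)), e⟫_ℝ) →
      ∃ F : E3 ≃ₗᵢ[ℝ] E3, (F = L ∨ F = twinRepFrame L) ∧ ∃ v z : E3,
        (v = upSlot₁ ∨ v = upSlot₂ ∨ v = upSlot₃) ∧ (∀ σ : ℤ → ℤ, SteerLaunchAt (1 / 3) F σ e z v) ∧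
        1 / 2 ≤ ⟪upFrame F e v, e⟫_ℝ ∧
        τ ≤ ⟪upFrame F e (basalMirror (bestCapper (twinFrame (upFrame F e) (upFrame F e e₃)) (upFrame F e e₃) z)), e⟫_ℝ ∧
        ∀ (w : ℤ → ℤ) (i : ℤ), τ ≤ steerRise (upFrame F e) w e z v i := by
    intro F v hF hv hhalf ⟨z, hz, hze, hsteep, hcap⟩
    have hvS : v ∈ fccSlots ∧ v 2 = Real.sqrt (2 / 3) := by
      rcases hv with rfl | rfl | rfl
      · exact ⟨s1, upSlot₁_coord.2.2⟩
      · exact ⟨s2, upSlot₂_coord.2.2⟩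
      · exact ⟨s3, upSlot₃_coord.2.2⟩
    refine ⟨F, hF, v, z, hv, fun σ => ⟨hz, hze, hvS.1, hvS.2, hsteep, fun i _ => by linarith⟩, hhalf, hcap, fun w i => ?_⟩
    by_cases hw : w i = 1
    · rw [steerRise_of_eq_one _ _ _ _ hw]; linarith
    · unfold steerRise; rw [if_neg hw]; exact hcap
  -- the best of the six rises
  obtain ⟨m, hmem, hmax⟩ := Finset.exists_max_image
    ({⟪G₀ upSlot₁, e⟫_ℝ, ⟪G₀ upSlot₂, e⟫_ℝ, ⟪G₀ upSlot₃, e⟫_ℝ, -⟪G₀ (basalMirror upSlot₁), e⟫_ℝ, -⟪G₀ (basalMirror upSlot₂), e⟫_ℝ,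
      -⟪G₀ (basalMirror upSlot₃), e⟫_ℝ} : Finset ℝ) id ⟨⟪G₀ upSlot₁, e⟫_ℝ, by simp⟩
  have l1 : ⟪G₀ upSlot₁, e⟫_ℝ ≤ m := hmax _ (by simp)
  have l2 : ⟪G₀ upSlot₂, e⟫_ℝ ≤ m := hmax _ (by simp)
  have l3 : ⟪G₀ upSlot₃, e⟫_ℝ ≤ m := hmax _ (by simp)
  have l4 : -⟪G₀ (basalMirror upSlot₁), e⟫_ℝ ≤ m := hmax _ (by simp)
  have l5 : -⟪G₀ (basalMirror upSlot₂), e⟫_ℝ ≤ m := hmax _ (by simp)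
  have l6 : -⟪G₀ (basalMirror upSlot₃), e⟫_ℝ ≤ m := hmax _ (by simp)
  have hmt : 1 / 2 ≤ m := by
    obtain ⟨u, hu, hu2, hor⟩ := exists_slot_or_capper_inner_ge_half ν hνn hν2
    have l1' := l1; have l2' := l2; have l3' := l3; have l4' := l4; have l5' := l5; have l6' := l6
    rw [hGe] at l1' l2' l3' l4' l5' l6'
    rcases eq_upSlot_of_apply_two hu hu2 with rfl | rfl | rfl <;> rcases hor with h | h <;> linarith
  simp only [Finset.mem_insert, Finset.mem_singleton] at hmem
  have tw : ∀ v w : E3, ⟪upFrame (twinRepFrame L) e v, e⟫_ℝ = -⟪G₀ (basalMirror v), e⟫_ℝ ∧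
      -⟪upFrame (twinRepFrame L) e (basalMirror w), e⟫_ℝ = ⟪G₀ w, e⟫_ℝ := fun v w => twinRep_rises L e v w
  have hGt : 0 ≤ ((upFrame (twinRepFrame L) e).symm e) 2 := upFrame_axis_nonneg _ e
  have hG0 : 0 ≤ (G₀.symm e) 2 := upFrame_axis_nonneg L e
  rcases hmem with h | h | h | h | h | h
  · refine pack L upSlot₁ (Or.inl rfl) hu1 (by rw [h] at hmt; exact hmt) ?_
    exact exists_launch_of_tilt_core hcore G₀ he hG0 hT0 hu1 hu2 hu3 (Ne.symm n12) (Ne.symm n13) n23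
      (by rw [h] at hmt; exact hmt) (by linarith) (by linarith)
  · refine pack L upSlot₂ (Or.inl rfl) hu2 (by rw [h] at hmt; exact hmt) ?_
    exact exists_launch_of_tilt_core hcore G₀ he hG0 hT0 hu2 hu1 hu3 n12 (Ne.symm n23) n13
      (by rw [h] at hmt; exact hmt) (by linarith) (by linarith)
  · refine pack L upSlot₃ (Or.inl rfl) hu3 (by rw [h] at hmt; exact hmt) ?_
    exact exists_launch_of_tilt_core hcore G₀ he hG0 hT0 hu3 hu1 hu2 n13 n23 n12
      (by rw [h] at hmt; exact hmt) (by linarith) (by linarith)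
  · refine pack (twinRepFrame L) upSlot₁ (Or.inr rfl) hu1 (by rw [(tw upSlot₁ upSlot₁).1, ← h]; exact hmt) ?_
    exact exists_launch_of_tilt_core hcore (upFrame (twinRepFrame L) e) he hGt hTt hu1 hu2 hu3 (Ne.symm n12) (Ne.symm n13) n23
      (by rw [(tw upSlot₁ upSlot₁).1, ← h]; exact hmt)
      (by rw [(tw upSlot₁ upSlot₂).2, (tw upSlot₁ upSlot₁).1]; linarith)
      (by rw [(tw upSlot₁ upSlot₃).2, (tw upSlot₁ upSlot₁).1]; linarith)
  · refine pack (twinRepFrame L) upSlot₂ (Or.inr rfl) hu2 (by rw [(tw upSlot₂ upSlot₂).1, ← h]; exact hmt) ?_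
    exact exists_launch_of_tilt_core hcore (upFrame (twinRepFrame L) e) he hGt hTt hu2 hu1 hu3 n12 (Ne.symm n23) n13
      (by rw [(tw upSlot₂ upSlot₂).1, ← h]; exact hmt)
      (by rw [(tw upSlot₂ upSlot₁).2, (tw upSlot₂ upSlot₂).1]; linarith)
      (by rw [(tw upSlot₂ upSlot₃).2, (tw upSlot₂ upSlot₂).1]; linarith)
  · refine pack (twinRepFrame L) upSlot₃ (Or.inr rfl) hu3 (by rw [(tw upSlot₃ upSlot₃).1, ← h]; exact hmt) ?_
    exact exists_launch_of_tilt_core hcore (upFrame (twinRepFrame L) e) he hGt hTt hu3 hu1 hu2 n13 n23 n12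
      (by rw [(tw upSlot₃ upSlot₃).1, ← h]; exact hmt)
      (by rw [(tw upSlot₃ upSlot₁).2, (tw upSlot₃ upSlot₃).1]; linarith)
      (by rw [(tw upSlot₃ upSlot₂).2, (tw upSlot₃ upSlot₃).1]; linarith)

/-- **WEAK ⇒ STEEP TILT, 60° form: a plate tilted by `≤ 60°` (`⟪L e₃, e⟫² ≥ 1/4`) launches a steered family of strength `≥ 1/2` on every bilayer**
(some presentation `F ∈ {L, twinRepFrame L}`, `SteerLaunchAt (1/3)` for every word). -/
theorem exists_rep_steerLaunch_half_of_tilt (L : E3 ≃ₗᵢ[ℝ] E3) {e : E3} (he : ‖e‖ = 1) (htilt : 1 / 4 ≤ ⟪L e₃, e⟫_ℝ ^ 2) :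
    ∃ F : E3 ≃ₗᵢ[ℝ] E3, (F = L ∨ F = twinRepFrame L) ∧ ∃ v z : E3,
      (v = upSlot₁ ∨ v = upSlot₂ ∨ v = upSlot₃) ∧ (∀ σ : ℤ → ℤ, SteerLaunchAt (1 / 3) F σ e z v) ∧
      1 / 2 ≤ ⟪upFrame F e v, e⟫_ℝ ∧
      1 / 2 ≤ ⟪upFrame F e (basalMirror (bestCapper (twinFrame (upFrame F e) (upFrame F e e₃)) (upFrame F e e₃) z)), e⟫_ℝ ∧
      ∀ (w : ℤ → ℤ) (i : ℤ), 1 / 2 ≤ steerRise (upFrame F e) w e z v i :=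
  exists_rep_steerLaunch_of_tilt_core (by norm_num) le_rfl fluxTilt_core L he (by linarith)

/-- **WEAK ⇒ STEEP TILT, sharp form: a plate tilted by `≤ 77°` (`⟪L e₃, e⟫² ≥ 1/20`) launches a steered family of strength `≥ 9/20` on every
bilayer.**  Since `9/20 + √3/6 ≥ √2·13/25`, both plates of a flux-sliver pair have their axes within `13°` of the wall plane. -/
theorem exists_rep_steerLaunch_sharp_of_tilt (L : E3 ≃ₗᵢ[ℝ] E3) {e : E3} (he : ‖e‖ = 1) (htilt : 1 / 20 ≤ ⟪L e₃, e⟫_ℝ ^ 2) :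
    ∃ F : E3 ≃ₗᵢ[ℝ] E3, (F = L ∨ F = twinRepFrame L) ∧ ∃ v z : E3,
      (v = upSlot₁ ∨ v = upSlot₂ ∨ v = upSlot₃) ∧ (∀ σ : ℤ → ℤ, SteerLaunchAt (1 / 3) F σ e z v) ∧
      1 / 2 ≤ ⟪upFrame F e v, e⟫_ℝ ∧
      9 / 20 ≤ ⟪upFrame F e (basalMirror (bestCapper (twinFrame (upFrame F e) (upFrame F e e₃)) (upFrame F e e₃) z)), e⟫_ℝ ∧
      ∀ (w : ℤ → ℤ) (i : ℤ), 9 / 20 ≤ steerRise (upFrame F e) w e z v i :=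
  exists_rep_steerLaunch_of_tilt_core (by norm_num) (by norm_num) fluxTilt_core_sharp L he (by linarith)

/-- **Every plate launches a family of strength `≥ √3/6` on every bilayer** (some presentation; `SteerLaunchAt (1/3)` for every word). -/
theorem exists_rep_steerLaunch_floor (L : E3 ≃ₗᵢ[ℝ] E3) {e : E3} (he : ‖e‖ = 1) :
    ∃ F : E3 ≃ₗᵢ[ℝ] E3, (F = L ∨ F = twinRepFrame L) ∧ ∃ v z : E3,
      (v = upSlot₁ ∨ v = upSlot₂ ∨ v = upSlot₃) ∧ (∀ σ : ℤ → ℤ, SteerLaunchAt (1 / 3) F σ e z v) ∧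
      ∀ (w : ℤ → ℤ) (i : ℤ), Real.sqrt 3 / 6 ≤ steerRise (upFrame F e) w e z v i := by
  obtain ⟨F, hF, v, z, hv, hL, hslot, hcap, -⟩ := exists_rep_steerLaunch_mean L he
  refine ⟨F, hF, v, z, hv, hL, fun w i => ?_⟩
  have h36 : Real.sqrt 3 / 6 ≤ 1 / 2 := by
    have : Real.sqrt 3 ≤ 2 := by
      rw [show (2:ℝ) = Real.sqrt (2 ^ 2) by rw [Real.sqrt_sq (by norm_num)]]
      exact Real.sqrt_le_sqrt (by norm_num)
    linarith
  by_cases hw : w i = 1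
  · rw [steerRise_of_eq_one _ _ _ _ hw]; linarith
  · unfold steerRise; rw [if_neg hw]; exact hcap

/-- **A pair with ONE plate tilted by `≤ 77°` (`⟪L₁ e₃, e₃⟫² ≥ 1/20`) is never in the flux-pair sliver**: there are presentations `F₁ ∈ {L₁, twinRepFrame L₁}`,
`F₂ ∈ {L₂, twinRepFrame L₂}` and launches (plate 1 toward `e₃`, plate 2 toward `−e₃`, `SteerLaunchAt (1/3)` for every word) whose step rises satisfy
`steerRise₁ i + steerRise₂ j ≥ √2·(13/25)` for ALL bilayer pairs and all presented words — the negation of the launch-wise flux-pair failure.  Stated for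
the tilted plate being plate 1; the mirror statement follows by exchanging the roles (`e ↦ −e`). -/
theorem exists_rep_launches_sum_ge_of_tilt (L₁ L₂ : E3 ≃ₗᵢ[ℝ] E3) (htilt : 1 / 20 ≤ ⟪L₁ e₃, e₃⟫_ℝ ^ 2) :
    ∃ F₁ F₂ : E3 ≃ₗᵢ[ℝ] E3, (F₁ = L₁ ∨ F₁ = twinRepFrame L₁) ∧ (F₂ = L₂ ∨ F₂ = twinRepFrame L₂) ∧ ∃ v₁ z₁ v₂ z₂ : E3,
      (∀ σ : ℤ → ℤ, SteerLaunchAt (1 / 3) F₁ σ e₃ z₁ v₁) ∧ (∀ σ : ℤ → ℤ, SteerLaunchAt (1 / 3) F₂ σ (-e₃) z₂ v₂) ∧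
      ∀ (w₁ w₂ : ℤ → ℤ) (i j : ℤ),
        Real.sqrt 2 * (13 / 25) ≤ steerRise (upFrame F₁ e₃) w₁ e₃ z₁ v₁ i + steerRise (upFrame F₂ (-e₃)) w₂ (-e₃) z₂ v₂ j := by
  have hn : ‖(-e₃ : E3)‖ = 1 := by rw [norm_neg, norm_e₃_eq_one]
  obtain ⟨F₁, hF₁, v₁, z₁, -, hL₁, -, -, h₁⟩ := exists_rep_steerLaunch_sharp_of_tilt L₁ norm_e₃_eq_one htilt
  obtain ⟨F₂, hF₂, v₂, z₂, -, hL₂, h₂⟩ := exists_rep_steerLaunch_floor L₂ hn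
  refine ⟨F₁, F₂, hF₁, hF₂, v₁, z₁, v₂, z₂, hL₁, hL₂, fun w₁ w₂ i j => ?_⟩
  have := sqrt_two_mul_c0_le_sharp_add
  linarith [h₁ w₁ i, h₂ w₂ j]

end Summit.Ventures.Crystal3D.Cruxes.TextureLiminf.TexShadow

end
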